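import Summits.QuantumFields.YangMills.Theorems.UVSeamRec.Negative.PenetrationIdentityExterior
import HarnessLib

/-!
# Crux `NT` (stmt-QuantumFields-19353), stub `stub_refpkgT : RefPkgT`: THE CLASSICAL SHADOW — what the registered exterior-
# oscillation ceilings (clauses 1–3) say at `β = ∞` about the GROUND STATES of every femto box, with the SAME constants

Helper file (`--supports stmt-QuantumFields-19353`) of the fleet lead prover of crux `NT` (unit `ym-spine-19353-p1`, GEN 14).
Hypothesis-free, general compact `G`, any lattice representation `r`; built on the disprover's (`ym-cdisprove-19353-penetration`)
zero-temperature Laplace step for the cube kernels, `BoundaryLawPenetration.kerE_eventually_ge/le` (Hwang's theorem, degenerate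
form; `cubeMinimisers` = ground states of the boundary Wilson action of the cube glued into the exterior) and the flatness of the
identity exterior (`dens_eq_dens_one_of_mem_cubeMinimisers_one`).

THE POINT.  Clauses 1–3 of the registered package are asked for ALL `β ≥ βᵢ` on every cube `(c, b)` with `b·a(β) ≤ ℓ`; since
`a(β) → 0`, EVERY lattice cube size `b` is eventually admissible, so the clauses have `β → ∞` consequences at each FIXED lattice
geometry — purely variational statements about Wilson-action ground states, β-free, testable by classical minimisation (the
disprover's kit `cool2`), and carrying the package's own constants `C₁, C₂, C₃`:

* §1 tools (the disprover's standing `[SecondCountableTopology G]` hypothesis is discharged inline: a compact group with a faithful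
  continuous matrix representation is second countable, tree `Theorems.secondCountable_of_latticeRep`): `isCompact_cubeMinimisers`,
  `exists_isMinOn_dens_cubeMinimisers` / `exists_isMaxOn_dens_cubeMinimisers`, `dens_one` (`dens x 1 = 6N`),
  `tendsto_kerE_of_eq_on_cubeMinimisers` (a continuous observable CONSTANT `= t` on the ground states has `kerE β → t`);
* §2 **clause 1 ⇒ `groundState_dens_ranges_of_e1osc`**: for every cube, every site `x` of depth `d ≥ 1` and every two exteriors
  `η, η'`: `min_{GS(η)} dens_x − max_{GS(η')} dens_x ≤ C₁/d⁴` (the ground-state ranges of the density under two exteriors cannot be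
  separated by more than `C₁/d⁴`); **`exists_groundState_dens_ge_of_e1osc`**: at depth `d ≥ 2`, EVERY exterior has a ground state
  whose density at `x` is `≥ 6N − C₁/d⁴` (the identity exterior is flat) — the disprover's «funnel law» for at least one ground
  state is a NECESSARY condition of clause 1 with constant exactly `C₁`; `deficit_le_of_e1osc`: the quantitative form of the disprover's
  `not_e1osc_of_classicalDensDeficitAtRate` (ONE exterior all of whose ground states have deficit `≥ g` at depth `d` forces `g ≤ C₁/d⁴`);
* §3 **clause 2 ⇒ `zeroTemp_kerCov_le_of_e2osc`**: `kerCov_β^{1}(dens_x, dens_y) → 0` (`tendsto_kerCov_one_dens`, unique flat ground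
  state), hence for EVERY exterior `η` and every `e > 0`, eventually in `β`,
  `|kerCov_β^η(dens_x, dens_y)| ≤ C₂/min(d_x,d_y)⁴/(1+‖y−x‖)⁴ + e`: the ZERO-TEMPERATURE conditional covariance of the densities in a
  frustrated box — which need not vanish when the ground states of `η` form a continuum on which `dens` varies (thermal
  order-by-disorder selects a law on that continuum) — is capped by the registered two-point envelope;
* §4 **clause 3 ⇒ `zeroTemp_kerK3_le_of_e3osc`**: the same for the conditional third cumulant (`tendsto_kerK3_one`).

So the disprover's classical programme extends from clause 1 (flux PENETRATION, decided FUNNEL by kit j279298/j279301: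
`sup d⁴·(plane deficit) ≈ 1.74` at `SU(2)`, i.e. far below the corner price `C₁ ≥ 24`) to clauses 2–3 (ground-state DEGENERACY of
frustrated femto boxes), with the package's constants as the pass marks.

HONEST FRAMING.  Consequences of the registered clauses at fixed lattice geometry as `β → ∞`; necessary conditions on instances;
nothing here asserts that any exterior violates them; no floor, not AF, not NT, not the seam, not the gap; not Clay.
-/

set_option autoImplicit false

noncomputable section

open MeasureTheory Filter Topology
open Literature.MathematicalPhysics.QuantumFieldTheory Literature.MathematicalPhysics.QuantumLattice
open Literature.Probability.LatticeModels
open Summit.QuantumFields.YangMills.Cruxes.OSLegsFromFemtoAndGap.DlrCollarTransfer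
open Summit.QuantumFields.YangMills.Cruxes.UVSeamRec.BoundaryLawPenetration

namespace Summit.QuantumFields.YangMills.Cruxes.NT.ClassicalShadow

/-! ## §1 Tools -/

variable {G : Type} [Group G] [TopologicalSpace G] [IsTopologicalGroup G] [CompactSpace G]
  [MeasurableSpace G] [BorelSpace G] (r : LatticeRep G)

omit [MeasurableSpace G] [BorelSpace G] in
/-- The ground-state set of a cube with a given exterior is compact. [folklore] -/
theorem isCompact_cubeMinimisers (c : Fin 4 → ℤ) (b : ℕ) (η : LGConfig 4 G) : IsCompact (cubeMinimisers G r c b η) := by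
  have hglue : Continuous fun ζ : ↥(cubeEdges c b) → G => glueWith (cubeEdges c b) ζ η :=
    (continuous_glueWith_prod (cubeEdges c b)).comp (Continuous.prodMk_right η)
  have hSc : Continuous fun ζ : ↥(cubeEdges c b) → G =>
      wilsonBoundaryAction r.ρ (cubeEdges c b) (glueWith (cubeEdges c b) ζ η) :=
    (continuous_wilsonBoundaryAction r.ρ r.continuous (cubeEdges c b)).comp hglue
  have hclosed : IsClosed (cubeMinimisers G r c b η) := by
    have e : cubeMinimisers G r c b η = ⋂ ζ' : ↥(cubeEdges c b) → G,
        {ζ | wilsonBoundaryAction r.ρ (cubeEdges c b) (glueWith (cubeEdges c b) ζ η) ≤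
          wilsonBoundaryAction r.ρ (cubeEdges c b) (glueWith (cubeEdges c b) ζ' η)} := by
      ext ζ; simp [cubeMinimisers]
    rw [e]
    exact isClosed_iInter fun ζ' => isClosed_le hSc continuous_const
  exact hclosed.isCompact

/-- The density at `x` attains its MINIMUM over the ground states of a cube. [folklore] -/
theorem exists_isMinOn_dens_cubeMinimisers (c : Fin 4 → ℤ) (b : ℕ) (η : LGConfig 4 G) (x : Fin 4 → ℤ) :
    ∃ ζ ∈ cubeMinimisers G r c b η, ∀ ζ' ∈ cubeMinimisers G r c b η,
      dens G r x (glueWith (cubeEdges c b) ζ η) ≤ dens G r x (glueWith (cubeEdges c b) ζ' η) := by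
  have hcont : Continuous fun ζ : ↥(cubeEdges c b) → G => dens G r x (glueWith (cubeEdges c b) ζ η) :=
    (continuous_dens r x).comp ((continuous_glueWith_prod (cubeEdges c b)).comp (Continuous.prodMk_right η))
  obtain ⟨ζ, hζ, hmin⟩ := (isCompact_cubeMinimisers r c b η).exists_isMinOn (cubeMinimisers_nonempty c b η) hcont.continuousOn
  exact ⟨ζ, hζ, fun ζ' hζ' => hmin hζ'⟩

/-- The density at `x` attains its MAXIMUM over the ground states of a cube. [folklore] -/
theorem exists_isMaxOn_dens_cubeMinimisers (c : Fin 4 → ℤ) (b : ℕ) (η : LGConfig 4 G) (x : Fin 4 → ℤ) :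
    ∃ ζ ∈ cubeMinimisers G r c b η, ∀ ζ' ∈ cubeMinimisers G r c b η,
      dens G r x (glueWith (cubeEdges c b) ζ' η) ≤ dens G r x (glueWith (cubeEdges c b) ζ η) := by
  have hcont : Continuous fun ζ : ↥(cubeEdges c b) → G => dens G r x (glueWith (cubeEdges c b) ζ η) :=
    (continuous_dens r x).comp ((continuous_glueWith_prod (cubeEdges c b)).comp (Continuous.prodMk_right η))
  obtain ⟨ζ, hζ, hmax⟩ := (isCompact_cubeMinimisers r c b η).exists_isMaxOn (cubeMinimisers_nonempty c b η) hcont.continuousOn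
  exact ⟨ζ, hζ, fun ζ' hζ' => hmax hζ'⟩

/-- The flat value of the action density: `dens x 1 = 6N`. [folklore] -/
theorem dens_one (x : Fin 4 → ℤ) : dens G r x 1 = 6 * (r.N : ℝ) := by
  show actionDensity r.ρ (configShift (-x) 1) = 6 * (r.N : ℝ)
  rw [configShift_one]
  unfold actionDensity
  simp only [plaquetteObs_one, Fin.sum_univ_four]
  simp [Fin.lt_def]
  ring

/-- A unit map tending to `0` eventually puts every fixed lattice cube size in femto range: `b · a(β) ≤ ℓ`. [folklore] -/
theorem eventually_mul_le_of_tendsto_zero {a : ℝ → ℝ} (ha0 : Tendsto a atTop (𝓝 0)) {ℓ : ℝ} (hℓ : 0 < ℓ) (b : ℕ) :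
    ∀ᶠ β in atTop, (b : ℝ) * a β ≤ ℓ := by
  have h : Tendsto (fun β => (b : ℝ) * a β) atTop (𝓝 0) := by simpa using ha0.const_mul (b : ℝ)
  exact (h.eventually (ge_mem_nhds hℓ)).mono fun _ h => h

/-- **A continuous observable constant on the ground states has that constant as its zero-temperature kernel mean**: if `F = t` on
`cubeMinimisers c b η` then `kerE β c b η F → t` as `β → ∞`. [cite: Hwang1980, Thm 2.1] -/
theorem tendsto_kerE_of_eq_on_cubeMinimisers (c : Fin 4 → ℤ) (b : ℕ) (η : LGConfig 4 G) {F : LGConfig 4 G → ℝ}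
    (hF : Continuous F) {t : ℝ} (ht : ∀ ζ ∈ cubeMinimisers G r c b η, F (glueWith (cubeEdges c b) ζ η) = t) :
    Tendsto (fun β : ℝ => kerE G r β c b η F) atTop (𝓝 t) := by
  -- a compact group with a faithful continuous matrix representation is second countable (tree:
  -- `Theorems.secondCountable_of_latticeRep`, GronwallGap desk; inlined to keep the import closure light)
  haveI : SecondCountableTopology G := (Continuous.isClosedEmbedding r.continuous r.injective).isEmbedding.secondCountableTopology
  rw [Metric.tendsto_atTop']
  intro ε hε
  have hε2 : 0 < ε / 2 := half_pos hε
  have h1 := kerE_eventually_ge (G := G) (r := r) c b η hF (t := t) (fun ζ hζ => (ht ζ hζ).ge) hε2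
  have h2 := kerE_eventually_le (G := G) (r := r) c b η hF (t := t) (fun ζ hζ => (ht ζ hζ).le) hε2
  obtain ⟨β₀, hβ₀⟩ := Filter.eventually_atTop.1 (h1.and h2)
  refine ⟨β₀, fun β hβ => ?_⟩
  obtain ⟨ha, hb⟩ := hβ₀ β hβ.le
  rw [Real.dist_eq, abs_lt]
  constructor <;> linarith

/-! ## §2 Clause 1 at `β = ∞`: ground-state density ranges -/

section ClauseOne

variable (a : ℝ → ℝ)

/-- **Clause 1 ⇒ the ground-state ranges of two exteriors are within `C₁/d⁴`.**  If clause 1 of the registered package holds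
(`β ≥ β₁`, cubes `b·a(β) ≤ ℓ`, `a → 0`, `ℓ > 0`, constant `C₁`), then for every lattice cube `(c, b)`, every site `x` of depth
`d ≥ 1` and every two exteriors `η, η'`: `min_{ζ ∈ GS(η)} dens_x(ζ) − max_{ζ' ∈ GS(η')} dens_x(ζ') ≤ C₁/d⁴`. [folklore] -/
theorem groundState_dens_ranges_of_e1osc (ha0 : Tendsto a atTop (𝓝 0)) {C₁ ℓ : ℝ} (hℓ : 0 < ℓ)
    (hE1 : ∃ β₁ : ℝ, ∀ β : ℝ, β₁ ≤ β → ∀ (c : Fin 4 → ℤ) (b : ℕ), (b : ℝ) * a β ≤ ℓ →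
      ∀ (η η' : LGConfig 4 G) (x : Fin 4 → ℤ), 1 ≤ depth c b x →
        |kerE G r β c b η (dens G r x) - kerE G r β c b η' (dens G r x)| ≤ C₁ / (depth c b x : ℝ) ^ 4)
    (c : Fin 4 → ℤ) (b : ℕ) {x : Fin 4 → ℤ} (hx : 1 ≤ depth c b x) (η η' : LGConfig 4 G) :
    ∃ ζ ∈ cubeMinimisers G r c b η, ∃ ζ' ∈ cubeMinimisers G r c b η',
      (∀ ξ ∈ cubeMinimisers G r c b η, dens G r x (glueWith (cubeEdges c b) ζ η) ≤ dens G r x (glueWith (cubeEdges c b) ξ η)) ∧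
      (∀ ξ ∈ cubeMinimisers G r c b η', dens G r x (glueWith (cubeEdges c b) ξ η') ≤ dens G r x (glueWith (cubeEdges c b) ζ' η')) ∧
      dens G r x (glueWith (cubeEdges c b) ζ η) - dens G r x (glueWith (cubeEdges c b) ζ' η') ≤ C₁ / (depth c b x : ℝ) ^ 4 := by
  -- a compact group with a faithful continuous matrix representation is second countable (tree:
  -- `Theorems.secondCountable_of_latticeRep`, GronwallGap desk; inlined to keep the import closure light)
  haveI : SecondCountableTopology G := (Continuous.isClosedEmbedding r.continuous r.injective).isEmbedding.secondCountableTopology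
  obtain ⟨ζ, hζ, hmin⟩ := exists_isMinOn_dens_cubeMinimisers r c b η x
  obtain ⟨ζ', hζ', hmax⟩ := exists_isMaxOn_dens_cubeMinimisers r c b η' x
  refine ⟨ζ, hζ, ζ', hζ', hmin, hmax, ?_⟩
  by_contra hlt
  rw [not_le] at hlt
  set m := dens G r x (glueWith (cubeEdges c b) ζ η) with hm
  set M := dens G r x (glueWith (cubeEdges c b) ζ' η') with hM
  set gap : ℝ := (C₁ / (depth c b x : ℝ) ^ 4 + (m - M)) / 2 with hgap_def
  have hgap : gap < m - M := by rw [hgap_def]; linarith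
  have hgap' : C₁ / (depth c b x : ℝ) ^ 4 < gap := by rw [hgap_def]; linarith
  obtain ⟨β₀, hβ₀⟩ := exists_beta_response_of_classical (G := G) (r := r) c b η' η (continuous_dens r x) hgap hmax hmin
  obtain ⟨β₁, H1⟩ := hE1
  obtain ⟨β, hb, hβ0, hβ1⟩ : ∃ β, (b : ℝ) * a β ≤ ℓ ∧ β₀ ≤ β ∧ β₁ ≤ β := by
    obtain ⟨β, h⟩ := (((eventually_mul_le_of_tendsto_zero ha0 hℓ b).and
      ((eventually_ge_atTop β₀).and (eventually_ge_atTop β₁))).frequently).exists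
    exact ⟨β, h.1, h.2.1, h.2.2⟩
  have hosc := H1 β hβ1 c b hb η' η x hx
  have hresp := hβ₀ β hβ0
  linarith

/-- **Clause 1 ⇒ every exterior has a ground state with density `≥ 6N − C₁/d⁴` at depth `d ≥ 2`** (the identity exterior is
classically flat): the «funnel law» with the package's own constant, for at least one ground state of every frustrated femto box.
[folklore] -/
theorem exists_groundState_dens_ge_of_e1osc (ha0 : Tendsto a atTop (𝓝 0)) {C₁ ℓ : ℝ} (hℓ : 0 < ℓ)
    (hE1 : ∃ β₁ : ℝ, ∀ β : ℝ, β₁ ≤ β → ∀ (c : Fin 4 → ℤ) (b : ℕ), (b : ℝ) * a β ≤ ℓ →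
      ∀ (η η' : LGConfig 4 G) (x : Fin 4 → ℤ), 1 ≤ depth c b x →
        |kerE G r β c b η (dens G r x) - kerE G r β c b η' (dens G r x)| ≤ C₁ / (depth c b x : ℝ) ^ 4)
    (c : Fin 4 → ℤ) (b : ℕ) {x : Fin 4 → ℤ} (hx : 2 ≤ depth c b x) (η : LGConfig 4 G) :
    ∃ ζ ∈ cubeMinimisers G r c b η, 6 * (r.N : ℝ) - C₁ / (depth c b x : ℝ) ^ 4 ≤ dens G r x (glueWith (cubeEdges c b) ζ η) := by
  obtain ⟨ζ₁, hζ₁, ζ, hζ, -, -, hle⟩ :=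
    groundState_dens_ranges_of_e1osc r a ha0 hℓ hE1 c b (le_trans one_le_two hx) 1 η
  refine ⟨ζ, hζ, ?_⟩
  rw [dens_eq_dens_one_of_mem_cubeMinimisers_one r hx hζ₁, dens_one] at hle
  linarith

/-- **Quantitative form of the disprover's `not_e1osc_of_classicalDensDeficitAtRate`.**  Under clause 1, a cube, a site `x` of depth
`d ≥ 2` and ONE exterior all of whose ground states have `dens_x ≤ 6N − g` force `g ≤ C₁/d⁴`. [folklore] -/
theorem deficit_le_of_e1osc (ha0 : Tendsto a atTop (𝓝 0)) {C₁ ℓ : ℝ} (hℓ : 0 < ℓ)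
    (hE1 : ∃ β₁ : ℝ, ∀ β : ℝ, β₁ ≤ β → ∀ (c : Fin 4 → ℤ) (b : ℕ), (b : ℝ) * a β ≤ ℓ →
      ∀ (η η' : LGConfig 4 G) (x : Fin 4 → ℤ), 1 ≤ depth c b x →
        |kerE G r β c b η (dens G r x) - kerE G r β c b η' (dens G r x)| ≤ C₁ / (depth c b x : ℝ) ^ 4)
    (c : Fin 4 → ℤ) (b : ℕ) {x : Fin 4 → ℤ} (hx : 2 ≤ depth c b x) (η : LGConfig 4 G) {g : ℝ}
    (hdef : ∀ ζ ∈ cubeMinimisers G r c b η, dens G r x (glueWith (cubeEdges c b) ζ η) ≤ 6 * (r.N : ℝ) - g) :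
    g ≤ C₁ / (depth c b x : ℝ) ^ 4 := by
  obtain ⟨ζ, hζ, hge⟩ := exists_groundState_dens_ge_of_e1osc r a ha0 hℓ hE1 c b hx η
  linarith [hdef ζ hζ]

end ClauseOne

/-! ## §3 Clause 2 at `β = ∞`: the zero-temperature conditional covariance of every exterior -/

section ClauseTwo

/-- `kerE_β^{1}(dens_x) → 6N` (depth `≥ 2`, identity exterior). [folklore] -/
theorem tendsto_kerE_one_dens (c : Fin 4 → ℤ) (b : ℕ) {x : Fin 4 → ℤ} (hx : 2 ≤ depth c b x) :
    Tendsto (fun β : ℝ => kerE G r β c b 1 (dens G r x)) atTop (𝓝 (6 * (r.N : ℝ))) :=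
  tendsto_kerE_of_eq_on_cubeMinimisers r c b 1 (continuous_dens r x) fun ζ hζ => by
    rw [dens_eq_dens_one_of_mem_cubeMinimisers_one r hx hζ, dens_one]

/-- `kerE_β^{1}(dens_x · dens_y) → (6N)²` (depths `≥ 2`, identity exterior). [folklore] -/
theorem tendsto_kerE_one_dens_mul (c : Fin 4 → ℤ) (b : ℕ) {x y : Fin 4 → ℤ} (hx : 2 ≤ depth c b x) (hy : 2 ≤ depth c b y) :
    Tendsto (fun β : ℝ => kerE G r β c b 1 (fun U => dens G r x U * dens G r y U)) atTop
      (𝓝 (6 * (r.N : ℝ) * (6 * (r.N : ℝ)))) :=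
  tendsto_kerE_of_eq_on_cubeMinimisers r c b 1 ((continuous_dens r x).mul (continuous_dens r y)) fun ζ hζ => by
    show dens G r x _ * dens G r y _ = _
    rw [dens_eq_dens_one_of_mem_cubeMinimisers_one r hx hζ, dens_eq_dens_one_of_mem_cubeMinimisers_one r hy hζ, dens_one r x,
      dens_one r y]

/-- **`kerCov_β^{1}(dens_x, dens_y) → 0`**: the identity exterior has a unique (flat) classical value, so its zero-temperature
conditional covariance vanishes. [folklore] -/
theorem tendsto_kerCov_one_dens (c : Fin 4 → ℤ) (b : ℕ) {x y : Fin 4 → ℤ} (hx : 2 ≤ depth c b x) (hy : 2 ≤ depth c b y) :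
    Tendsto (fun β : ℝ => kerCov G r β c b 1 (dens G r x) (dens G r y)) atTop (𝓝 0) := by
  have h := (tendsto_kerE_one_dens_mul r c b hx hy).sub ((tendsto_kerE_one_dens r c b hx).mul (tendsto_kerE_one_dens r c b hy))
  rw [sub_self] at h
  exact h

variable (a : ℝ → ℝ)

/-- **Clause 2 ⇒ the zero-temperature conditional covariance of EVERY exterior is capped by the registered two-point envelope.**
If clause 2 of the registered package holds (`β ≥ β₂`, cubes `b·a(β) ≤ ℓ`, `a → 0`, `ℓ > 0`, constant `C₂`), then for every cube,
every exterior `η`, all sites `x, y` of depth `≥ 2` and every `e > 0`, eventually in `β`: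
`|kerCov_β^η(dens_x, dens_y)| ≤ C₂ / min(d_x, d_y)⁴ / (1 + ‖y − x‖)⁴ + e`. [folklore] -/
theorem zeroTemp_kerCov_le_of_e2osc (ha0 : Tendsto a atTop (𝓝 0)) {C₂ ℓ : ℝ} (hℓ : 0 < ℓ)
    (hE2 : ∃ β₂ : ℝ, ∀ β : ℝ, β₂ ≤ β → ∀ (c : Fin 4 → ℤ) (b : ℕ), (b : ℝ) * a β ≤ ℓ →
      ∀ (η η' : LGConfig 4 G) (x y : Fin 4 → ℤ), 1 ≤ depth c b x → 1 ≤ depth c b y →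
        |kerCov G r β c b η (dens G r x) (dens G r y) - kerCov G r β c b η' (dens G r x) (dens G r y)| ≤
          C₂ / ((min (depth c b x) (depth c b y) : ℕ) : ℝ) ^ 4 / (1 + ‖siteToE (y - x)‖) ^ 4)
    (c : Fin 4 → ℤ) (b : ℕ) {x y : Fin 4 → ℤ} (hx : 2 ≤ depth c b x) (hy : 2 ≤ depth c b y) (η : LGConfig 4 G)
    {e : ℝ} (he : 0 < e) :
    ∀ᶠ β : ℝ in atTop, |kerCov G r β c b η (dens G r x) (dens G r y)| ≤
      C₂ / ((min (depth c b x) (depth c b y) : ℕ) : ℝ) ^ 4 / (1 + ‖siteToE (y - x)‖) ^ 4 + e := by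
  obtain ⟨β₂, H2⟩ := hE2
  have h0 : ∀ᶠ β : ℝ in atTop, |kerCov G r β c b 1 (dens G r x) (dens G r y)| ≤ e := by
    have h := (tendsto_kerCov_one_dens r c b hx hy).abs
    rw [abs_zero] at h
    exact (h.eventually (eventually_le_nhds he)).mono fun _ h => h
  filter_upwards [h0, eventually_mul_le_of_tendsto_zero ha0 hℓ b, eventually_ge_atTop β₂] with β hβ0 hb hβ2
  have hosc := H2 β hβ2 c b hb η 1 x y (le_trans one_le_two hx) (le_trans one_le_two hy)
  have htri := abs_sub_abs_le_abs_sub (kerCov G r β c b η (dens G r x) (dens G r y)) (kerCov G r β c b 1 (dens G r x) (dens G r y))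
  linarith

/-- The diagonal case `x = y`: **the zero-temperature conditional VARIANCE of the density under every exterior is eventually
`≤ C₂/d⁴ + e`.** [folklore] -/
theorem zeroTemp_kerVar_le_of_e2osc (ha0 : Tendsto a atTop (𝓝 0)) {C₂ ℓ : ℝ} (hℓ : 0 < ℓ)
    (hE2 : ∃ β₂ : ℝ, ∀ β : ℝ, β₂ ≤ β → ∀ (c : Fin 4 → ℤ) (b : ℕ), (b : ℝ) * a β ≤ ℓ →
      ∀ (η η' : LGConfig 4 G) (x y : Fin 4 → ℤ), 1 ≤ depth c b x → 1 ≤ depth c b y →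
        |kerCov G r β c b η (dens G r x) (dens G r y) - kerCov G r β c b η' (dens G r x) (dens G r y)| ≤
          C₂ / ((min (depth c b x) (depth c b y) : ℕ) : ℝ) ^ 4 / (1 + ‖siteToE (y - x)‖) ^ 4)
    (c : Fin 4 → ℤ) (b : ℕ) {x : Fin 4 → ℤ} (hx : 2 ≤ depth c b x) (η : LGConfig 4 G) {e : ℝ} (he : 0 < e) :
    ∀ᶠ β : ℝ in atTop, |kerCov G r β c b η (dens G r x) (dens G r x)| ≤ C₂ / (depth c b x : ℝ) ^ 4 + e := by
  have h := zeroTemp_kerCov_le_of_e2osc r a ha0 hℓ hE2 c b hx hx η he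
  have h0 : ‖siteToE (x - x)‖ = 0 := by
    rw [sub_self, show siteToE (0 : Site 4) = 0 from by ext j; simp [siteToE_apply], norm_zero]
  simp only [min_self, h0, add_zero, one_pow, div_one] at h
  exact h

end ClauseTwo

/-! ## §4 Clause 3 at `β = ∞`: the zero-temperature conditional third cumulant of every exterior -/

section ClauseThree

/-- `kerE_β^{1}(dens_x · dens_y · dens_z) → (6N)³` (depths `≥ 2`, identity exterior). [folklore] -/
theorem tendsto_kerE_one_dens_mul_mul (c : Fin 4 → ℤ) (b : ℕ) {x y z : Fin 4 → ℤ} (hx : 2 ≤ depth c b x)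
    (hy : 2 ≤ depth c b y) (hz : 2 ≤ depth c b z) :
    Tendsto (fun β : ℝ => kerE G r β c b 1 (fun U => dens G r x U * dens G r y U * dens G r z U)) atTop
      (𝓝 (6 * (r.N : ℝ) * (6 * (r.N : ℝ)) * (6 * (r.N : ℝ)))) :=
  tendsto_kerE_of_eq_on_cubeMinimisers r c b 1 (((continuous_dens r x).mul (continuous_dens r y)).mul (continuous_dens r z))
    fun ζ hζ => by
      show dens G r x _ * dens G r y _ * dens G r z _ = _
      rw [dens_eq_dens_one_of_mem_cubeMinimisers_one r hx hζ, dens_eq_dens_one_of_mem_cubeMinimisers_one r hy hζ,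
        dens_eq_dens_one_of_mem_cubeMinimisers_one r hz hζ, dens_one r x, dens_one r y, dens_one r z]

/-- **`kerK3_β^{1}(x, y, z) → 0`**: the zero-temperature conditional third cumulant of the identity exterior vanishes. [folklore] -/
theorem tendsto_kerK3_one (c : Fin 4 → ℤ) (b : ℕ) {x y z : Fin 4 → ℤ} (hx : 2 ≤ depth c b x) (hy : 2 ≤ depth c b y)
    (hz : 2 ≤ depth c b z) :
    Tendsto (fun β : ℝ => kerK3 G r β c b 1 x y z) atTop (𝓝 0) := by
  have hx1 := tendsto_kerE_one_dens r c b hx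
  have hy1 := tendsto_kerE_one_dens r c b hy
  have hz1 := tendsto_kerE_one_dens r c b hz
  have hxy := tendsto_kerE_one_dens_mul r c b hx hy
  have hxz := tendsto_kerE_one_dens_mul r c b hx hz
  have hyz := tendsto_kerE_one_dens_mul r c b hy hz
  have hxyz := tendsto_kerE_one_dens_mul_mul r c b hx hy hz
  have h := (((hxyz.sub (hx1.mul hyz)).sub (hy1.mul hxz)).sub (hz1.mul hxy)).add
    ((hx1.mul hy1).mul hz1 |>.const_mul 2)
  have e : 6 * (r.N : ℝ) * (6 * (r.N : ℝ)) * (6 * (r.N : ℝ)) - 6 * (r.N : ℝ) * (6 * (r.N : ℝ) * (6 * (r.N : ℝ))) -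
      6 * (r.N : ℝ) * (6 * (r.N : ℝ) * (6 * (r.N : ℝ))) - 6 * (r.N : ℝ) * (6 * (r.N : ℝ) * (6 * (r.N : ℝ))) +
      2 * (6 * (r.N : ℝ) * (6 * (r.N : ℝ)) * (6 * (r.N : ℝ))) = 0 := by ring
  rw [e] at h
  refine h.congr' (Eventually.of_forall fun β => ?_)
  simp only [kerK3]

variable (a : ℝ → ℝ)

/-- **Clause 3 ⇒ the zero-temperature conditional third cumulant of EVERY exterior is capped by the registered three-point envelope.**
[folklore] -/
theorem zeroTemp_kerK3_le_of_e3osc (ha0 : Tendsto a atTop (𝓝 0)) {C₃ ℓ : ℝ} (hℓ : 0 < ℓ)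
    (hE3 : ∃ β₃ : ℝ, ∀ β : ℝ, β₃ ≤ β → ∀ (c : Fin 4 → ℤ) (b : ℕ), (b : ℝ) * a β ≤ ℓ →
      ∀ (η η' : LGConfig 4 G) (x y z : Fin 4 → ℤ), 1 ≤ depth c b x → 1 ≤ depth c b y → 1 ≤ depth c b z →
        |kerK3 G r β c b η x y z - kerK3 G r β c b η' x y z| ≤
          C₃ / ((min (min (depth c b x) (depth c b y)) (depth c b z) : ℕ) : ℝ) ^ 4 /
            (1 + min (min ‖siteToE (y - x)‖ ‖siteToE (z - y)‖) ‖siteToE (z - x)‖) ^ 8)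
    (c : Fin 4 → ℤ) (b : ℕ) {x y z : Fin 4 → ℤ} (hx : 2 ≤ depth c b x) (hy : 2 ≤ depth c b y) (hz : 2 ≤ depth c b z)
    (η : LGConfig 4 G) {e : ℝ} (he : 0 < e) :
    ∀ᶠ β : ℝ in atTop, |kerK3 G r β c b η x y z| ≤
      C₃ / ((min (min (depth c b x) (depth c b y)) (depth c b z) : ℕ) : ℝ) ^ 4 /
        (1 + min (min ‖siteToE (y - x)‖ ‖siteToE (z - y)‖) ‖siteToE (z - x)‖) ^ 8 + e := by
  obtain ⟨β₃, H3⟩ := hE3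
  have h0 : ∀ᶠ β : ℝ in atTop, |kerK3 G r β c b 1 x y z| ≤ e := by
    have h := (tendsto_kerK3_one r c b hx hy hz).abs
    rw [abs_zero] at h
    exact (h.eventually (eventually_le_nhds he)).mono fun _ h => h
  filter_upwards [h0, eventually_mul_le_of_tendsto_zero ha0 hℓ b, eventually_ge_atTop β₃] with β hβ0 hb hβ3
  have hosc := H3 β hβ3 c b hb η 1 x y z (le_trans one_le_two hx) (le_trans one_le_two hy) (le_trans one_le_two hz)
  have htri := abs_sub_abs_le_abs_sub (kerK3 G r β c b η x y z) (kerK3 G r β c b 1 x y z)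
  linarith

end ClauseThree

end Summit.QuantumFields.YangMills.Cruxes.NT.ClassicalShadow

end
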